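import Summits.ABC.IUTFork.ForkGenuineWindowSharpExplicit
import Literature.IUT.LogVolume.DifferentOrdGaloisFibre
import Literature.IUT.LogVolume.CompletionLocalFieldsUnramified
import Literature.IUT.LogVolume.GenuineLogThetaPointGalois
import HarnessLib

/-!
# The fork at [IUTchIII] Corollary 3.12 at a GENUINE input: the sharp lower window in the currency of the GLOBAL
# log-different `log(𝔡^K)` — `HullEstimateOf I δ ⟹ slotResidue + ((ℓ⋇+3)/2 − [F₀:ℚ])·log(𝔡^K) ≤ δ`
# ([IUTchIV] Thm. 1.10 Steps (ii), (v); Dupuy–Hilado §4.12)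

Record-only PROOF file (D-0012) of the abc-iut cell (campaign-S seat abc-iut-S4, gen 6); TAKES NO SIDE. Sequel to
`ForkGenuineWindowSharpExplicit` (this seat): there `HullEstimateOf I δ ⟹ slotResidue(T(I)) + D_expl(I) ≤ δ` with the CLOSED
FORM `D_expl(I) = Σ_{p∈T(I)} (((ℓ⋇+3)/2)·Σ_{u|p} Pr(u)·d(K_{u̲}) − Σ_{u|p} d(K_{u̲}))·log p`. HERE the two sums over the
completions are converted into the ONE global quantity that [IUTchIV] Thm. 1.10 Step (ii) controls — the normalised
log-different `log(𝔡^K) = ndeg K (differentDivisor K)` of the number field `K` (Def. 1.9 (ii), p. 23):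

* `dSum_le_finrank_mul_sum_weight_mul` — `Σ_{u|p} d(K_{u̲}) ≤ [F₀:ℚ]·Σ_{u|p} Pr(u)·d(K_{u̲})` (`Pr(u) = n_u/[F₀:ℚ] ≥ 1/[F₀:ℚ]`,
  `d ≥ 0`), so `D_expl(I) ≥ ((ℓ⋇+3)/2 − [F₀:ℚ])·Σ_{p∈T(I)} Σ_{u|p} Pr(u)·d(K_{u̲})·log p`
  (`dExplicit_closedForm_ge`);
* **`sum_supportPrimes_weight_mul_differentOrd_eq_ndeg`** — for `K/F₀` GALOIS ([IUTchI] Rmk. 3.1.5 at a datum):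
  `Σ_{p∈T(I)} Σ_{u|p} Pr(u)·d(K_{u̲})·log p = log(𝔡^K)` EXACTLY: per prime this is abc-iut-L5/S-lane's
  `sum_localDegree_mul_differentOrd_div_eq` (`= log(𝔡^K_{v_ℚ})`, Step (v) p. 28), and the support primes
  `T(I) ⊇ {p : p ∣ 2·disc K}` carry the whole different (at `p ∤ disc K` every completion is absolutely unramified,
  abc-iut-w5-lineage's `absRamificationIdx_rescaledCompletion_eq_one_of_not_dvd_discr`, so `d(K_w) = 0`);
* **`slotResidue_add_mul_ndeg_le_of_hullEstimateOf`** — `K/F₀` Galois: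
  `HullEstimateOf I δ ⟹ slotResidue(T(I)) + ((ℓ⋇+3)/2 − [F₀:ℚ])·log(𝔡^K) ≤ δ`;
* at the `λ`-line (`T : Cor22.ThetaVolumeDatumAt P l`; `K/F_mod` Galois is a THEOREM of the datum, abc-iut-L5/S2's
  `Cor22.ThetaVolumeDatumAt.isGalois_fieldOfModuli_K`): **`PointDict.slotResidue_add_mul_ndeg_le_of_hullVolumeAtDatum`** —
  `Cor22.HullVolumeAtDatum P l δ ⟹ slotResidue(T) + ((ℓ⋇+3)/2 − [F_mod:ℚ])·log(𝔡^{K}) ≤ δ` for EVERY genuine datum `T`.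

READING for VERDICT ¶7 (numbers, not a side). With `δ = B(P,l) = (l+1)/4·{(1+12d_mod/l)(log 𝔡^{F_tpd} + log 𝔣^{F_tpd}) + 2 log l
+ 52 + (20/3)·l*_mod·log 𝔰^≤}` and `(ℓ⋇+3)/2 = (l+5)/4`: the (U)-line estimate `hvol`/`stub_hullRegimeAbove` asserts at every
datum `slotResidue(T) ≤ B(P,l) − ((l+5)/4 − d_mod)·log(𝔡^K)`. The tree's Step (ii) bound is the UPPER one
(`Cor22.ThetaVolumeDatumAt.ndeg_differentDivisor_le`: `log(𝔡^K) ≤ log 𝔡^{F_tpd} + log 𝔣^{F_tpd} + 2 log l + 21`); the LOWER one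
needed to cash this — `log(𝔡^K) ≥ log 𝔡^{F_tpd} + (1 − 1/l)·log 𝔣^{F_tpd}` (print's first display of Step (ii), p. 24,
plus `l ∣ e(w|v)` at the bad places, abc-iut-w5-d009's `ThetaData.l_dvd_ramificationIdx_of_under_mem_VFbad`) — is NOT proved
here; with it the slack left to the (Ind1) slot residue is `≈ 4·d_mod·(log-diff + log-cond) + (l+1)/4·(2 log l + 52 +
(20/3)·l*_mod·log 𝔰^≤)`, i.e. O(d_mod) conductors, not `(l+1)/4` of them. Nothing here asserts `HullEstimateOf`, `Cor312Of`
or the existence of data; (Ind1)/(Ind2)/hull are the tree's typings of the disputed corpus [claim: Mochizuki2012, status: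
disputed]; the number theory is classical. No side taken on [IUTchIII] Cor. 3.12; typed ≠ proved. PROOF-ONLY file.
[cite: Mochizuki2012, IUTchIV Def. 1.9 (ii) p. 23, Thm. 1.10 Steps (ii), (v) p. 24, 27–29] [cite: DupuyHilado2025, Def. 3.6.3, §4.12]
-/

noncomputable section

open Set Literature.IUT.LogVolume NumberField IsDedekindDomain Literature.NumberTheory.NumberFields
open scoped Pointwise

namespace Summit.ABC.IUTFork.GenuineContent

section LogDiff

variable {F₀ : Type} [Field F₀] [NumberField F₀] {K : Type} [Field K] [NumberField K] [Algebra F₀ K]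
variable (I : ThetaVolumeInput F₀ K)

/-! ## 1. One unweighted copy of the completions' differents is at most `[F₀:ℚ]` weighted copies -/

/-- **`Σ_{u|p} d(K_{u̲}) ≤ [F₀:ℚ]·Σ_{u|p} Pr(u)·d(K_{u̲})`**: `Pr(u) = n_u/[F₀:ℚ]` with `n_u ≥ 1` and `d(K_{u̲}) ≥ 0`.
[cite: DupuyHilado2025, §3.6] -/
theorem dSum_le_finrank_mul_sum_weight_mul {p : ℕ} [hp : Fact p.Prime] :
    dSum p (fun u : placesOver F₀ p => (I.σ.localFieldFamily p hp.out).k u) ≤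
      (Module.finrank ℚ F₀ : ℝ) *
        ∑ u : placesOver F₀ p, weight F₀ u.1 * differentOrd p ((I.σ.localFieldFamily p hp.out).k u) := by
  unfold dSum
  rw [Finset.mul_sum]
  refine Finset.sum_le_sum fun u _ => ?_
  have hd : 0 ≤ differentOrd p ((I.σ.localFieldFamily p hp.out).k u) := differentOrd_nonneg p _
  have hF : (0 : ℝ) < Module.finrank ℚ F₀ := by exact_mod_cast Module.finrank_pos
  have hn : (1 : ℝ) ≤ localDegree F₀ u.1 := by exact_mod_cast localDegree_pos F₀ u.1
  have hw : (1 : ℝ) ≤ (Module.finrank ℚ F₀ : ℝ) * weight F₀ u.1 := by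
    unfold weight
    rw [mul_div_cancel₀ _ hF.ne']
    exact hn
  calc differentOrd p ((I.σ.localFieldFamily p hp.out).k u)
      = 1 * differentOrd p ((I.σ.localFieldFamily p hp.out).k u) := (one_mul _).symm
    _ ≤ ((Module.finrank ℚ F₀ : ℝ) * weight F₀ u.1) * differentOrd p ((I.σ.localFieldFamily p hp.out).k u) :=
        mul_le_mul_of_nonneg_right hw hd
    _ = (Module.finrank ℚ F₀ : ℝ) * (weight F₀ u.1 * differentOrd p ((I.σ.localFieldFamily p hp.out).k u)) := by
        ring

/-- **`D_expl(I) ≥ ((ℓ⋇+3)/2 − [F₀:ℚ])·Σ_{p∈T(I)} Σ_{u|p} Pr(u)·d(K_{u̲})·log p`** (the closed form of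
`ForkGenuineWindowSharpExplicit` with the unweighted copy bounded by `[F₀:ℚ]` weighted ones).
[cite: Mochizuki2012, IUTchIV Thm. 1.10 Step (v) p. 28–29] -/
theorem dExplicit_closedForm_ge :
    (((I.X.lstar : ℝ) + 3) / 2 - Module.finrank ℚ F₀) *
        ∑ p ∈ I.supportPrimes,
          (if hp : p.Prime then
            haveI : Fact p.Prime := ⟨hp⟩
            (∑ u : placesOver F₀ p, weight F₀ u.1 * differentOrd p ((I.σ.localFieldFamily p hp).k u)) * Real.log p
           else 0) ≤
      ∑ p ∈ I.supportPrimes,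
        (if hp : p.Prime then
          haveI : Fact p.Prime := ⟨hp⟩
          ((((I.X.lstar : ℝ) + 3) / 2) *
              ∑ u : placesOver F₀ p, weight F₀ u.1 * differentOrd p ((I.σ.localFieldFamily p hp).k u)
            - dSum p (fun u : placesOver F₀ p => (I.σ.localFieldFamily p hp).k u)) * Real.log p
         else 0) := by
  rw [Finset.mul_sum]
  refine Finset.sum_le_sum fun p hpT => ?_
  have hp' : p.Prime := I.prime_of_mem_supportPrimes hpT
  haveI hp : Fact p.Prime := ⟨hp'⟩
  simp only [dif_pos hp']
  have hlog : 0 ≤ Real.log p := Real.log_nonneg (by exact_mod_cast hp'.one_lt.le)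
  have h := dSum_le_finrank_mul_sum_weight_mul I (p := p)
  nlinarith

/-! ## 2. `K/F₀` Galois: the support primes carry the whole of `log(𝔡^K)` -/

/-- At a prime `p ∤ disc K` every completion of `K` is absolutely unramified, so its different is trivial:
`d(K_w) = 0` (`e = 1`, Serre III §6 Prop. 13). [cite: SerreLocalFields1979, Ch. III §6 Prop. 13] -/
theorem differentOrd_rescaledCompletion_eq_zero_of_not_dvd_discr {p : ℕ} [Fact p.Prime]
    (w : HeightOneSpectrum (𝓞 K)) (hw : ((p : ℕ) : 𝓞 K) ∈ w.asIdeal) (hdisc : ¬ (p : ℤ) ∣ NumberField.discr K) :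
    differentOrd p (RescaledCompletion K p w hw) = 0 := by
  have he := absRamificationIdx_rescaledCompletion_eq_one_of_not_dvd_discr K p w hw hdisc
  have h1 : ¬ p ∣ absRamificationIdx p (RescaledCompletion K p w hw) := by
    rw [he, Nat.dvd_one]
    exact (Fact.out : p.Prime).one_lt.ne'
  rw [differentOrd_eq_of_not_dvd p (RescaledCompletion K p w hw) h1, he]
  norm_num

/-- A place of `K` whose residue characteristic is not a support prime of `I` has trivial local different term
(`T(I) ⊇` the prime factors of `2·|disc K|`). [cite: Mochizuki2012, IUTchIV Thm. 1.10 Step (vi) p. 29] -/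
theorem localDifferentTerm_eq_zero_of_residueChar_notMem (w : HeightOneSpectrum (𝓞 K))
    (hw : residueChar K w ∉ I.supportPrimes) :
    (haveI : Fact (residueChar K w).Prime := ⟨residueChar_prime K w⟩
     (localDeg K w : ℝ) *
        differentOrd (residueChar K w)
          (RescaledCompletion K (residueChar K w) w (natCast_residueChar_mem K w)) *
      Real.log (residueChar K w)) = 0 := by
  haveI : Fact (residueChar K w).Prime := ⟨residueChar_prime K w⟩
  have hdisc : ¬ ((residueChar K w : ℕ) : ℤ) ∣ NumberField.discr K := by
    intro hdvd
    apply hw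
    unfold ThetaVolumeInput.supportPrimes
    refine Finset.mem_union_left _ (Nat.mem_primeFactors.mpr ⟨residueChar_prime K w, ?_, ?_⟩)
    · exact Dvd.dvd.mul_left (Int.natAbs_dvd_natAbs.mpr hdvd |>.trans (by simp)) 2
    · exact mul_ne_zero two_ne_zero (Int.natAbs_ne_zero.mpr (NumberField.discr_ne_zero K))
  rw [differentOrd_rescaledCompletion_eq_zero_of_not_dvd_discr w (natCast_residueChar_mem K w) hdisc]
  ring

/-- **`deg(𝔡^K_ADiv) = Σ_{p∈T(I)} Σ_{w∈V(K)_p} ord_w(𝔇_{K/ℤ})·log 𝐍(w)`**: the support primes of a genuine input carry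
the whole different of `K` (the places of `K` of residue characteristic outside `T(I)` are absolutely unramified).
[cite: Mochizuki2012, IUTchIV Def. 1.9 (ii) p. 23, Thm. 1.10 Step (vi) p. 29] -/
theorem degF_differentDivisor_eq_sum_supportPrimes :
    degF K (differentDivisor K) =
      ∑ p ∈ I.supportPrimes, ∑ w ∈ placesOver K p, differentDivisor K (Sum.inr w) * logNorm K w := by
  classical
  have hT : ∀ p ∈ I.supportPrimes, p.Prime := fun p hp => I.prime_of_mem_supportPrimes hp
  -- the union of the fibres over `T(I)`
  have hdisj : (I.supportPrimes : Set ℕ).PairwiseDisjoint (placesOver K) := by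
    intro p hp q hq hpq
    haveI : Fact p.Prime := ⟨hT p hp⟩
    haveI : Fact q.Prime := ⟨hT q hq⟩
    refine Finset.disjoint_left.mpr fun w hwp hwq => hpq ?_
    rw [mem_placesOver_iff_residueChar] at hwp hwq
    exact hwp.symm.trans hwq
  rw [← Finset.sum_biUnion hdisj]
  set S := I.supportPrimes.biUnion (placesOver K) with hS
  set U := S ∪ (finite_setOf_multiplicity_ne_zero K (differentIdeal_ne_bot' K)).toFinset with hU
  have hdeg := degF_differentDivisor_eq_sum_local_of_subset K U (fun v hv => by
    rw [hU, Finset.mem_union, Set.Finite.mem_toFinset]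
    exact Or.inr hv)
  rw [hdeg]
  -- the local term at `w ∈ S` is `dD(w)·log N(w)`
  have hterm : ∀ w : HeightOneSpectrum (𝓞 K),
      (haveI : Fact (residueChar K w).Prime := ⟨residueChar_prime K w⟩
       (localDeg K w : ℝ) *
          differentOrd (residueChar K w) (RescaledCompletion K (residueChar K w) w (natCast_residueChar_mem K w)) *
        Real.log (residueChar K w)) = differentDivisor K (Sum.inr w) * logNorm K w := by
    intro w
    haveI : Fact (residueChar K w).Prime := ⟨residueChar_prime K w⟩
    exact (differentDivisor_apply_mul_logNorm_eq K (residueChar K w) w (natCast_residueChar_mem K w)).symm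
  -- the terms outside `S` vanish
  have hS_sub : S ⊆ U := Finset.subset_union_left
  rw [← Finset.sum_subset hS_sub (fun w hwU hwS => ?_)]
  · exact Finset.sum_congr rfl fun w _ => hterm w
  · refine localDifferentTerm_eq_zero_of_residueChar_notMem I w fun hres => hwS ?_
    rw [hS, Finset.mem_biUnion]
    haveI : Fact (residueChar K w).Prime := ⟨residueChar_prime K w⟩
    exact ⟨residueChar K w, hres, (mem_placesOver_iff_residueChar w).mpr rfl⟩

/-- **`K/F₀` Galois: `Σ_{p∈T(I)} Σ_{u|p} Pr(u)·d(K_{u̲})·log p = log(𝔡^K) = ndeg K (differentDivisor K)`** — the Step (v)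
different term of a genuine input, summed over its support primes, IS the normalised global log-different of `K`
(per prime: `= log(𝔡^K_{v_ℚ})`, abc-iut-L5/S-lane's `sum_localDegree_mul_differentOrd_div_eq`; the support primes carry
the whole different, `degF_differentDivisor_eq_sum_supportPrimes`). [cite: Mochizuki2012, IUTchIV Def. 1.9 (ii) p. 23, Thm. 1.10 Step (v) p. 28] -/
theorem sum_supportPrimes_weight_mul_differentOrd_eq_ndeg [IsGalois F₀ K] :
    ∑ p ∈ I.supportPrimes,
        (if hp : p.Prime then
          haveI : Fact p.Prime := ⟨hp⟩
          (∑ u : placesOver F₀ p, weight F₀ u.1 * differentOrd p ((I.σ.localFieldFamily p hp).k u)) * Real.log p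
         else 0) = ndeg K (differentDivisor K) := by
  have hK : (0 : ℝ) < Module.finrank ℚ K := by exact_mod_cast Module.finrank_pos
  rw [ndeg_apply, degF_differentDivisor_eq_sum_supportPrimes I, Finset.sum_div]
  refine Finset.sum_congr rfl fun p hpT => ?_
  have hp' : p.Prime := I.prime_of_mem_supportPrimes hpT
  haveI hp : Fact p.Prime := ⟨hp'⟩
  rw [dif_pos hp', ← sum_localDegree_mul_differentOrd_div_eq F₀ K I.σ p, Finset.sum_div, Finset.sum_mul,
    Finset.sum_mul]
  refine Finset.sum_congr rfl fun u _ => ?_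
  unfold weight
  ring

/-- **THE LOWER WINDOW IN `log(𝔡^K)`-CURRENCY** (`K/F₀` Galois): for every genuine input and every `δ`,
`HullEstimateOf I δ ⟹ slotResidue(T(I)) + ((ℓ⋇+3)/2 − [F₀:ℚ])·log(𝔡^K) ≤ δ` — the hull-volume estimate leaves to the
(Ind1) slot residue only `δ` MINUS `(l+5)/4 − [F₀:ℚ]` normalised log-differents of `K`, the very quantity whose UPPER
bound print's Step (ii) supplies. Nothing asserted about any input. [cite: Mochizuki2012, IUTchIV Thm. 1.10 Steps (ii), (v) p. 24, 27–29]
[cite: DupuyHilado2025, §4.12] -/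
theorem slotResidue_add_mul_ndeg_le_of_hullEstimateOf [IsGalois F₀ K] {δ : ℝ} (h : I.HullEstimateOf δ) :
    I.X.slotResidue I.supportPrimes
        + (((I.X.lstar : ℝ) + 3) / 2 - Module.finrank ℚ F₀) * ndeg K (differentDivisor K) ≤ δ := by
  have h1 := slotResidue_add_closedForm_le_of_hullEstimateOf I h
  have h2 := dExplicit_closedForm_ge I
  rw [sum_supportPrimes_weight_mul_differentOrd_eq_ndeg I] at h2
  linarith

/-- **The two-sided ARITHMETIC window in `log(𝔡^K)`-currency** (`K/F₀` Galois): `slotResidue + explicitDeltaRest ≤ δ ⟹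
HullEstimateOf I δ ⟹ slotResidue + ((ℓ⋇+3)/2 − [F₀:ℚ])·log(𝔡^K) ≤ δ`. Pure packaging; nothing asserted about any input.
[cite: Mochizuki2012, IUTchIV Thm. 1.10 Step (v) p. 27–28] [cite: DupuyHilado2025, §4.12] -/
theorem hullEstimateOf_window_ndeg [IsGalois F₀ K] (δ : ℝ) :
    (I.X.slotResidue I.supportPrimes + DHData.explicitDeltaRest I ≤ δ → I.HullEstimateOf δ) ∧
    (I.HullEstimateOf δ →
      I.X.slotResidue I.supportPrimes
        + (((I.X.lstar : ℝ) + 3) / 2 - Module.finrank ℚ F₀) * ndeg K (differentDivisor K) ≤ δ) :=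
  ⟨hullEstimateOf_of_slotResidue_add_rest_le I, slotResidue_add_mul_ndeg_le_of_hullEstimateOf I⟩

end LogDiff

end Summit.ABC.IUTFork.GenuineContent

/-! ## 3. At the `λ`-line: `K/F_mod` Galois is a theorem of the datum -/

namespace Summit.ABC.IUTFork.PointDict

open Literature.NumberTheory.DiophantineGeometry.GenEll

variable {P : NFPoint} {l : ℕ}

/-- **`Cor22.HullVolumeAtDatum P l δ` forces `slotResidue(T) + ((ℓ⋇+3)/2 − [F_mod:ℚ])·log(𝔡^K) ≤ δ` at EVERY genuine datum
`T` of `(P, l)`**, `log(𝔡^K) = ndeg T.K (differentDivisor T.K)` the normalised log-different of the datum's field `K = F(E_F[l])`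
(`K/F_mod` Galois: [IUTchI] Rmk. 3.1.5, the datum's `isGalois_fieldOfModuli_K`). With `δ = B(P,l)` (the `hvol` binder, the
`stub_hullRegimeAbove` conclusion of stmt-ABC-19678's skeleton) and print's Step (ii) (`T.ndeg_differentDivisor_le`, UPPER
bound) on record, the union-line estimate is an inequality of the (Ind1) slot residue against
`B(P,l) − ((l+5)/4 − d_mod)·log(𝔡^K)`. Nothing asserted about the existence of data; no side taken.
[claim: Mochizuki2012, status: disputed] -/
theorem slotResidue_add_mul_ndeg_le_of_hullVolumeAtDatum {δ : ℝ} (h : Cor22.HullVolumeAtDatum P l δ)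
    (T : Cor22.ThetaVolumeDatumAt P l) :
    (letI := T.instFieldF; letI := T.instNumberFieldF; letI := T.instFieldK; letI := T.instNumberFieldK
     letI := T.instAlgebraK; letI := T.instIsElliptic
     T.I.X.slotResidue T.I.supportPrimes
        + (((T.I.X.lstar : ℝ) + 3) / 2 - Module.finrank ℚ (Literature.IUT.HodgeTheaters.fieldOfModuli T.E)) *
            ndeg T.K (differentDivisor T.K)) ≤ δ := by
  letI := T.instFieldF; letI := T.instNumberFieldF; letI := T.instFieldK; letI := T.instNumberFieldK
  letI := T.instAlgebraK; letI := T.instIsElliptic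
  haveI := T.isGalois_fieldOfModuli_K
  exact GenuineContent.slotResidue_add_mul_ndeg_le_of_hullEstimateOf T.I (h T)

end Summit.ABC.IUTFork.PointDict

end
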